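import Literature.AlgebraicGeometry.Motives.FlasqueCohomology
import Literature.AlgebraicGeometry.Motives.Differentials
import Literature.AlgebraicGeometry.Morphisms.CechH1Refinement
import Mathlib.Topology.Sheaves.SheafCondition.UniqueGluing
import HarnessLib

/-!
# `H¹(X, F) = 0` forces `Ȟ¹(𝔘, F) = 0` on every open cover (Hartshorne III, Ex. 4.4)

For a sheaf of abelian groups `F` on a topological space `X` and an open cover `𝔘 = (U_i)`, the
natural map `Ȟ¹(𝔘, F) → H¹(X, F)` (Hartshorne III, Lemma 4.4) is injective; in particular
**`H¹(X, F) = 0` implies that every Čech `1`-cocycle of `F` on every open cover is a coboundary**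
(Hartshorne III, Ex. 4.4 (c): `lim_𝔘 Ȟ¹(𝔘, F) ⥲ H¹(X, F)`, together with the injectivity of the
refinement maps in degree `1`). This file proves the vanishing statement for Mathlib's sheaf
cohomology `Sheaf.H` (`Ext` from the constant sheaf `ℤ` in `Sheaf (Opens.grothendieckTopology X) Ab`)
and specialises it to the structure sheaf of a scheme in the language of this tree's Čech groups
`Ȟ¹(𝔘, 𝒪_X)` (`Morphisms/CechH1.lean`) and `H¹(X, 𝒪_X) = structureSheafCohomology X 1`
(`Motives/Differentials.lean`):

* `cechZeroSheaf F U` — the Čech sheaf `Č⁰(𝔘, F) : V ↦ Π_l F(U_l ∩ V)` (`= Π_l (j_l)_* F|_{U_l}`),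
  with the diagonal map `toCechZero : F ⟶ Č⁰(𝔘, F)`, a monomorphism when `𝔘` covers `X`
  (`mono_toCechZero`), and the short exact sequence `cechSES : 0 → F → Č⁰(𝔘, F) → Č⁰(𝔘, F)/F → 0`
  (`shortExact_cechSES`);
* `exists_app_eq_of_app_eq_zero_of_shortExact` — sections are left exact: for a short exact
  sequence of abelian sheaves on any site, a section of the middle term killed by `g` is, over the
  same object, the image of a section of the kernel;
* `exists_cech_coboundary_of_subsingleton_H_one` — **main theorem**: if `H¹(X, F) = 0` then for
  every open cover `𝔘` of `X` (indexed in the universe of `X`) every family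
  `c_{ij} ∈ F(U_i ∩ U_j)` with `c_{jk} - c_{ik} + c_{ij} = 0` on `U_i ∩ U_j ∩ U_k` is of the form
  `c_{ij} = b_j - b_i`;
* `cechZ1_le_cechB1_of_subsingleton_structureSheafCohomology`,
  `subsingleton_cechH1_of_subsingleton_structureSheafCohomology` — for a scheme `X` over a ring
  `A` with `H¹(X, 𝒪_X) = 0`: `Ž¹(𝔘, 𝒪_X) = B̌¹(𝔘, 𝒪_X)` and `Ȟ¹(𝔘, 𝒪_X) = 0` for every open cover
  `𝔘` of `X` (the sections and restriction maps of the abelian sheaf underlying `𝒪_X` are those of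
  `Morphisms.Sections`, definitionally: `structureSheafAb_obj`, `sheafSecRes_structureSheafAb`,
  `structureSheafCohomology_eq_H`); the primed versions `…'` allow covers indexed in any universe
  (reduction to the cover by all opens contained in some `U_i` and the injectivity of refinement
  maps on `Ȟ¹`, `Morphisms/CechH1Refinement.lean`).

## Proof

Not Hartshorne's hint (flasque embedding and the complex `D•(𝔘)`), but the following shortcut,
which needs no Čech-acyclicity of flasque sheaves. Embed `F` diagonally into the Čech sheaf
`G = Č⁰(𝔘, F)`; this is a monomorphism because `𝔘` covers `X`, so `0 → F → G → Q → 0` is short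
exact with `Q = G/F` (cokernel in the category of sheaves). (1) In `G` the cocycle `c` is a
coboundary for a formal reason: `h_i := (c_{l i})_l ∈ G(U_i)` has `h_j - h_i = (c_{lj} - c_{li})_l =
(c_{ij}|)_l = ι(c_{ij})` by the cocycle identity. (2) The images `q_i ∈ Q(U_i)` of the `h_i` agree
on overlaps (their difference is the image of `ι(c_{ij})`, which is `0` in `Q`), so they glue to
`q ∈ Q(X)`. (3) `H¹(X, F) = 0` makes `G(X) → Q(X)` surjective (long exact `Ext`-sequence, Mathlib
`Ext.covariant_sequence_exact₃` and `Sheaf.H.equiv₀`): `q` lifts to `h ∈ G(X)`. (4) `h_i - h|_{U_i}`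
is killed by `G → Q`, hence equals `ι(e_i)` with `e_i ∈ F(U_i)` (left exactness of sections:
`sheafToPresheaf ⋙ evaluation` preserves kernels). (5) Then `ι(e_j - e_i) = (h_j - h|) - (h_i - h|)
= h_j - h_i = ι(c_{ij})` on `U_i ∩ U_j`, and `ι` is injective on sections.

## References

* R. Hartshorne, *Algebraic Geometry*, GTM 52, Springer (1977): III, Lemma 4.4 (the natural map
  `Ȟᵖ(𝔘, F) → Hᵖ(X, F)`, PDF p. 277) and III, Ex. 4.4 (a)–(c) (`lim_𝔘 Ȟ¹(𝔘, F) ⥲ H¹(X, F)` for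
  every abelian sheaf on every topological space, PDF pp. 279–280), read in the held copy.
  [Hartshorne1977]
* Related, in the opposite direction (Čech-acyclic ⇒ acyclic, on sites):
  `Literature/Algebra/Homology/CartanCriterion.lean`.

## Design notes

* Everything is proved; no named facts (D-0026). Written as the algebraic-side input of a
  Čech-style comparison `H¹(S, 𝒪_S) = 0 ⇒ Ȟ¹(𝔘, 𝒪_S) = 0` (affine covers of a K3 surface) for
  `Surfaces.Huybrechts_K3_oddBetti_vanish` (`Surfaces/K3BettiNumbersProofs.lean`).
* The short complex is written in constructor form `ShortComplex.mk ι (cokernel.π ι) _`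
  (`cechSES`, equal to Mathlib's `ShortComplex.cokernelSequence ι`) so that `(cechSES F U).X₁`,
  `.X₂`, `.f` reduce to `F`, `Č⁰(𝔘, F)`, `ι` by projection reduction; this keeps `rw` with
  `map_sub`/naturality working on sections (the objects of `Sheaf J A`, an
  `ObjectProperty.FullSubcategory`, only unfold to `InducedCategory` at default transparency).
* The cover is indexed by `ι : Type u`, `u` the universe of `X` (the Čech sheaf takes values in
  `AddCommGrpCat.{u}`); covers indexed elsewhere can be reindexed by their image in `Opens X`.
* Mathlib searched (pin): no Čech-to-derived comparison for topological spaces or sites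
  (`Mathlib/Topology/Sheaves` has no Čech cohomology; `CategoryTheory/Sites/SheafCohomology` has
  `Sheaf.H`, `H.equiv₀` only). Nothing restated.
-/

open CategoryTheory Limits Opposite TopologicalSpace Abelian

universe v u

namespace Literature.AlgebraicGeometry.Motives

section CechSheaf

variable {X : TopCat.{u}} (F : Sheaf (Opens.grothendieckTopology X) AddCommGrpCat.{u}) {ι : Type u}
  (U : ι → Opens X)

/-- Restriction `F(W) → F(V)` of an abelian sheaf along `V ≤ W`, as an additive map. [folklore] -/
abbrev sheafSecRes {V W : Opens X} (h : V ≤ W) : F.obj.obj (op W) →+ F.obj.obj (op V) :=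
  (F.obj.map (homOfLE h).op).hom

/-- Restriction is transitive. [folklore] -/
theorem sheafSecRes_sheafSecRes {V W W' : Opens X} (h : V ≤ W) (h' : W ≤ W') (x : F.obj.obj (op W')) :
    sheafSecRes F h (sheafSecRes F h' x) = sheafSecRes F (h.trans h') x := by
  change (F.obj.map (homOfLE h').op ≫ F.obj.map (homOfLE h).op) x = _
  rw [← F.obj.map_comp]
  rfl

/-- Restriction to the same open is the identity. [folklore] -/
theorem sheafSecRes_self {V : Opens X} (x : F.obj.obj (op V)) : sheafSecRes F (le_refl V) x = x := by
  have : (homOfLE (le_refl V)).op = 𝟙 (op V) := Subsingleton.elim _ _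
  simp only [sheafSecRes, this, F.obj.map_id]
  rfl

/-- Proof-irrelevance of the inequality in `sheafSecRes`. [folklore] -/
theorem sheafSecRes_irrel {V W : Opens X} (h h' : V ≤ W) (x : F.obj.obj (op W)) :
    sheafSecRes F h x = sheafSecRes F h' x := rfl

/-- The Čech sheaf `Č⁰(𝔘, F) = Π_l (j_l)_*(F|_{U_l})`: `V ↦ Π_l F(U_l ∩ V)`, as a presheaf of
abelian groups (Hartshorne's `𝒞⁰(𝔘, F)`). [cite: Hartshorne1977, III §4, before Lemma 4.2 (PDF p. 276)] -/
def cechZeroPresheaf : TopCat.Presheaf AddCommGrpCat.{u} X where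
  obj V := AddCommGrpCat.of (∀ l, F.obj.obj (op (U l ⊓ V.unop)))
  map {V W} i := AddCommGrpCat.ofHom
    (AddMonoidHom.pi fun l ↦ (sheafSecRes F (inf_le_inf_left (U l) i.unop.le)).comp (Pi.evalAddMonoidHom _ l))
  map_id V := by
    ext x l
    change sheafSecRes F _ (x l) = x l
    exact sheafSecRes_self F (x l)
  map_comp {V W W'} i j := by
    ext x l
    change sheafSecRes F _ (x l) = sheafSecRes F _ (sheafSecRes F _ (x l))
    rw [sheafSecRes_sheafSecRes]

/-- Unfolding of the restriction maps of `Č⁰(𝔘, F)` (componentwise restriction). [folklore] -/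
theorem cechZeroPresheaf_map_apply {V W : Opens X} (i : W ≤ V) (x : ∀ l, F.obj.obj (op (U l ⊓ V))) (l : ι) :
    ((cechZeroPresheaf F U).map (homOfLE i).op).hom x l = sheafSecRes F (inf_le_inf_left (U l) i) (x l) :=
  rfl

/-- The Čech presheaf `Č⁰(𝔘, F)` is a sheaf (each factor `(j_l)_*(F|_{U_l})` is; glued
componentwise with Mathlib's unique-gluing sheaf condition). [folklore] -/
theorem cechZeroPresheaf_isSheaf : (cechZeroPresheaf F U).IsSheaf := by
  rw [TopCat.Presheaf.isSheaf_iff_isSheafUniqueGluing]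
  intro κ V sf hsf
  have hcompat : ∀ (l : ι) (a b : κ),
      sheafSecRes F (inf_le_inf_left (U l) (inf_le_left : V a ⊓ V b ≤ V a)) (sf a l) =
        sheafSecRes F (inf_le_inf_left (U l) (inf_le_right : V a ⊓ V b ≤ V b)) (sf b l) :=
    fun l a b ↦ congrFun (hsf a b) l
  have key : ∀ l, ∃! s : F.obj.obj (op (U l ⊓ iSup V)),
      ∀ a, sheafSecRes F (inf_le_inf_left (U l) (le_iSup V a)) s = sf a l := by
    intro l
    refine TopCat.Sheaf.existsUnique_gluing' (C := AddCommGrpCat.{u}) F (fun a ↦ U l ⊓ V a) (U l ⊓ iSup V)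
      (fun a ↦ homOfLE (inf_le_inf_left (U l) (le_iSup V a))) ?_ (fun a ↦ sf a l) ?_
    · rw [inf_iSup_eq]
    · intro a b
      have h := congrArg (sheafSecRes F (le_inf (inf_le_left.trans inf_le_left)
        (inf_le_inf inf_le_right inf_le_right) :
          (U l ⊓ V a) ⊓ (U l ⊓ V b) ≤ U l ⊓ (V a ⊓ V b))) (hcompat l a b)
      rw [sheafSecRes_sheafSecRes, sheafSecRes_sheafSecRes] at h
      exact h
  choose s hs hsu using key
  refine ⟨s, fun a ↦ funext fun l ↦ hs l a, fun s' hs' ↦ funext fun l ↦ hsu l (s' l) fun a ↦ ?_⟩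
  exact congrFun (hs' a) l

/-- The Čech sheaf `Č⁰(𝔘, F)` as an abelian sheaf on `X`. [cite: Hartshorne1977, III §4, before Lemma 4.2 (PDF p. 276)] -/
def cechZeroSheaf : Sheaf (Opens.grothendieckTopology X) AddCommGrpCat.{u} :=
  ⟨cechZeroPresheaf F U, cechZeroPresheaf_isSheaf F U⟩

/-- The diagonal map `ε : F ⟶ Č⁰(𝔘, F)`, `s ↦ (s|_{U_l ∩ V})_l` (Hartshorne's `ε : F → 𝒞⁰`).
[cite: Hartshorne1977, III Lemma 4.2 (PDF p. 276)] -/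
def toCechZero : F ⟶ cechZeroSheaf F U :=
  ObjectProperty.homMk
    { app := fun V ↦ AddCommGrpCat.ofHom
        (AddMonoidHom.pi fun l ↦ sheafSecRes F (inf_le_right : U l ⊓ V.unop ≤ V.unop))
      naturality := fun V W i ↦ by
        ext x
        funext l
        change sheafSecRes F _ (sheafSecRes F i.unop.le x) = sheafSecRes F _ (sheafSecRes F _ x)
        rw [sheafSecRes_sheafSecRes, sheafSecRes_sheafSecRes] }

/-- Unfolding of the diagonal map. [folklore] -/
theorem toCechZero_app_apply (V : Opens X) (x : F.obj.obj (op V)) (l : ι) :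
    ((toCechZero F U).hom.app (op V)).hom x l = sheafSecRes F (inf_le_right : U l ⊓ V ≤ V) x :=
  rfl

/-- The diagonal map `F ⟶ Č⁰(𝔘, F)` is a monomorphism when `𝔘` covers `X` (locality of `F`).
[cite: Hartshorne1977, III Lemma 4.2 (PDF p. 276)] -/
theorem mono_toCechZero (hU : iSup U = ⊤) : Mono (toCechZero F U) := by
  rw [Sheaf.Hom.mono_iff_presheaf_mono, NatTrans.mono_iff_mono_app]
  intro V
  rw [AddCommGrpCat.mono_iff_injective]
  intro x y hxy
  apply TopCat.Sheaf.eq_of_locally_eq' (C := AddCommGrpCat.{u}) F (fun l ↦ U l ⊓ V.unop) V.unop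
    (fun l ↦ homOfLE inf_le_right)
  · intro z hz
    have hz' : z ∈ (⊤ : Opens X) := trivial
    rw [← hU] at hz'
    obtain ⟨l, hl⟩ := Opens.mem_iSup.1 hz'
    exact Opens.mem_iSup.2 ⟨l, hl, hz⟩
  · intro l
    exact congrFun hxy l

end CechSheaf

section SectionsExact

universe w v' u'

variable {C : Type u'} [Category.{v'} C] {J : GrothendieckTopology C}
  [HasSheafify J AddCommGrpCat.{w}]
  {S : ShortComplex (Sheaf J AddCommGrpCat.{w})}

/-- **Sections are left exact**: for a short exact sequence `0 → F₁ → F₂ → F₃ → 0` of abelian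
sheaves on a site and any object `U`, a section of `F₂` over `U` killed by `g` is the image of a
section of `F₁` over the same `U` (`sheafToPresheaf ⋙ evaluation U` preserves the kernel of `g`).
[cite: Hartshorne1977, II Ex. 1.8 (`Γ(U, ·)` is left exact)] -/
theorem exists_app_eq_of_app_eq_zero_of_shortExact (hS : S.ShortExact) (U : Cᵒᵖ) (x₂ : S.X₂.obj.obj U)
    (hx : S.g.hom.app U x₂ = 0) : ∃ x₁ : S.X₁.obj.obj U, S.f.hom.app U x₁ = x₂ := by
  let Φ := sheafToPresheaf J AddCommGrpCat.{w} ⋙ (evaluation Cᵒᵖ AddCommGrpCat.{w}).obj U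
  have hker : IsLimit (KernelFork.ofι (S.map Φ).f (S.map Φ).zero) :=
    KernelFork.mapIsLimit _ hS.fIsKernel Φ
  have hex : (S.map Φ).Exact := ShortComplex.exact_of_f_is_kernel _ hker
  rw [ShortComplex.ab_exact_iff] at hex
  exact hex x₂ hx

end SectionsExact

section Main

variable {X : TopCat.{u}} (F : Sheaf (Opens.grothendieckTopology X) AddCommGrpCat.{u}) {ι : Type u}
  (U : ι → Opens X)

/-- Functoriality of restriction, for any abelian sheaf. [folklore] -/
theorem sheaf_map_map_apply (G : Sheaf (Opens.grothendieckTopology X) AddCommGrpCat.{u})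
    {V W W' : Opens X} (h : V ≤ W) (h' : W ≤ W') (x : G.obj.obj (op W')) :
    (G.obj.map (homOfLE h).op).hom ((G.obj.map (homOfLE h').op).hom x) =
      (G.obj.map (homOfLE (h.trans h')).op).hom x := by
  change (G.obj.map (homOfLE h').op ≫ G.obj.map (homOfLE h).op) x = _
  rw [← G.obj.map_comp]
  rfl

/-- The short complex `F → Č⁰(𝔘, F) → Č⁰(𝔘, F)/F` (cokernel taken in the category of sheaves); it is
short exact when `𝔘` covers `X` (`shortExact_cechSES`). Written with `ShortComplex.mk` (it is
Mathlib's `ShortComplex.cokernelSequence (toCechZero F U)`), see the design notes. [folklore] -/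
noncomputable abbrev cechSES : ShortComplex (Sheaf (Opens.grothendieckTopology X) AddCommGrpCat.{u}) :=
  ShortComplex.mk (toCechZero F U) (cokernel.π (toCechZero F U)) (cokernel.condition _)

/-- `0 → F → Č⁰(𝔘, F) → Č⁰(𝔘, F)/F → 0` is short exact when `𝔘` covers `X`. [folklore] -/
theorem shortExact_cechSES (hU : iSup U = ⊤) : (cechSES F U).ShortExact :=
  haveI := mono_toCechZero F U hU
  { exact := ShortComplex.cokernelSequence_exact (toCechZero F U)
    mono_f := ‹Mono (toCechZero F U)› }

/-- **`H¹(X, F) = 0` forces every Čech `1`-cocycle on every open cover to be a coboundary**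
(injectivity of `Ȟ¹(𝔘, F) → H¹(X, F)`, Hartshorne III Lemma 4.4 / Ex. 4.4, in vanishing form): for
a sheaf of abelian groups `F` on a topological space `X` with `H¹(X, F) = 0` (Mathlib `Sheaf.H`), an
open cover `(U_i)_{i ∈ ι}` of `X` and sections `c_{ij} ∈ F(U_i ∩ U_j)` with
`c_{jk}| - c_{ik}| + c_{ij}| = 0` on every `U_i ∩ U_j ∩ U_k`, there are `b_i ∈ F(U_i)` with
`c_{ij} = b_j| - b_i|`. See the module docstring for the proof.
[cite: Hartshorne1977, III Ex. 4.4 (c) with Lemma 4.4 (PDF pp. 277, 279–280)] -/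
theorem exists_cech_coboundary_of_subsingleton_H_one [Subsingleton (F.H 1)] (hU : iSup U = ⊤)
    (c : ∀ i j, F.obj.obj (op (U i ⊓ U j)))
    (hc : ∀ i j k,
      sheafSecRes F (le_inf (inf_le_left.trans inf_le_right) inf_le_right : U i ⊓ U j ⊓ U k ≤ U j ⊓ U k)
          (c j k) -
        sheafSecRes F (le_inf (inf_le_left.trans inf_le_left) inf_le_right : U i ⊓ U j ⊓ U k ≤ U i ⊓ U k)
          (c i k) +
        sheafSecRes F (inf_le_left : U i ⊓ U j ⊓ U k ≤ U i ⊓ U j) (c i j) = 0) :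
    ∃ b : ∀ i, F.obj.obj (op (U i)),
      ∀ i j, c i j = sheafSecRes F inf_le_right (b j) - sheafSecRes F inf_le_left (b i) := by
  have hS := shortExact_cechSES F U hU
  -- (1) the cochain `h_i = (c_{l i})_l ∈ Č⁰(𝔘, F)(U_i)` has coboundary `c`
  let h : ∀ i, (cechSES F U).X₂.obj.obj (op (U i)) := fun i l ↦ c l i
  have h2 : ∀ i j, ((cechSES F U).f.hom.app (op (U i ⊓ U j))).hom (c i j) =
      ((cechSES F U).X₂.obj.map (homOfLE (inf_le_right : U i ⊓ U j ≤ U j)).op).hom (h j) -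
        ((cechSES F U).X₂.obj.map (homOfLE (inf_le_left : U i ⊓ U j ≤ U i)).op).hom (h i) := by
    intro i j
    funext l
    change sheafSecRes F _ (c i j) = sheafSecRes F _ (c l j) - sheafSecRes F _ (c l i)
    have e := congrArg (sheafSecRes F (le_inf (le_inf inf_le_left (inf_le_right.trans inf_le_left))
      (inf_le_right.trans inf_le_right) : U l ⊓ (U i ⊓ U j) ≤ U l ⊓ U i ⊓ U j)) (hc l i j)
    rw [map_add, map_sub, map_zero, sheafSecRes_sheafSecRes, sheafSecRes_sheafSecRes, sheafSecRes_sheafSecRes] at e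
    rw [← sub_eq_zero, ← e]
    abel
  -- naturality of `f` and `g`, and `g ∘ f = 0`, on sections
  have natf : ∀ {V W : Opens X} (hVW : V ≤ W) (x : (cechSES F U).X₁.obj.obj (op W)),
      ((cechSES F U).f.hom.app (op V)).hom (((cechSES F U).X₁.obj.map (homOfLE hVW).op).hom x) =
        ((cechSES F U).X₂.obj.map (homOfLE hVW).op).hom (((cechSES F U).f.hom.app (op W)).hom x) :=
    fun hVW x ↦ by
    have e := ConcreteCategory.congr_hom ((cechSES F U).f.hom.naturality (homOfLE hVW).op) x
    simpa only [ConcreteCategory.comp_apply] using e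
  have nat : ∀ {V W : Opens X} (hVW : V ≤ W) (x : (cechSES F U).X₂.obj.obj (op W)),
      ((cechSES F U).g.hom.app (op V)).hom (((cechSES F U).X₂.obj.map (homOfLE hVW).op).hom x) =
        ((cechSES F U).X₃.obj.map (homOfLE hVW).op).hom (((cechSES F U).g.hom.app (op W)).hom x) :=
    fun hVW x ↦ by
    have e := ConcreteCategory.congr_hom ((cechSES F U).g.hom.naturality (homOfLE hVW).op) x
    simpa only [ConcreteCategory.comp_apply] using e
  have gf : ∀ (V : Opens X) (x : (cechSES F U).X₁.obj.obj (op V)),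
      ((cechSES F U).g.hom.app (op V)).hom (((cechSES F U).f.hom.app (op V)).hom x) = 0 := fun V x ↦ by
    have e := congrArg (fun t : (cechSES F U).X₁ ⟶ (cechSES F U).X₃ ↦ (t.hom.app (op V)).hom x)
      (cechSES F U).zero
    exact e
  -- (2) the images `q_i` of the `h_i` in `Q = Č⁰/F` are compatible, hence glue to `q ∈ Q(X)`
  let qi : ∀ i, (cechSES F U).X₃.obj.obj (op (U i)) :=
    fun i ↦ ((cechSES F U).g.hom.app (op (U i))).hom (h i)
  have hqi : TopCat.Presheaf.IsCompatible (cechSES F U).X₃.obj U qi := by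
    intro i j
    change ((cechSES F U).X₃.obj.map (homOfLE inf_le_left).op).hom
        (((cechSES F U).g.hom.app (op (U i))).hom (h i)) =
      ((cechSES F U).X₃.obj.map (homOfLE inf_le_right).op).hom
        (((cechSES F U).g.hom.app (op (U j))).hom (h j))
    rw [← nat, ← nat, ← sub_eq_zero, ← map_sub]
    have e := gf (U i ⊓ U j) (c i j)
    rw [h2 i j, map_sub] at e
    rw [map_sub, ← neg_sub, e, neg_zero]
  obtain ⟨q, hq, -⟩ := TopCat.Sheaf.existsUnique_gluing' (C := AddCommGrpCat.{u}) (cechSES F U).X₃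
    U ⊤ (fun i ↦ homOfLE le_top) hU.ge qi hqi
  -- (3) `H¹(X, F) = 0`: `Γ(X, Č⁰) → Γ(X, Q)` is onto, so `q` lifts to `hG ∈ Č⁰(𝔘, F)(X)`
  obtain ⟨x₂, hx₂⟩ := Ext.covariant_sequence_exact₃ _ hS
    ((Sheaf.H.equiv₀ (cechSES F U).X₃ isTerminalTop).symm q) (zero_add 1) (Subsingleton.elim _ _)
  have hhG : ((cechSES F U).g.hom.app (op ⊤)).hom (Sheaf.H.equiv₀ (cechSES F U).X₂ isTerminalTop x₂)
      = q := by
    have e : (cechSES F U).g.hom.app (op ⊤) (Sheaf.H.equiv₀ (cechSES F U).X₂ isTerminalTop x₂)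
        = q := by
      rw [Sheaf.H.equiv₀_naturality, Sheaf.H.map_apply, hx₂, AddEquiv.apply_symm_apply]
    exact e
  -- (4) `d_i = h_i - hG|_{U_i}` is killed by `g`, hence is `f(e_i)` with `e_i ∈ F(U_i)`
  have hd : ∀ i, ((cechSES F U).g.hom.app (op (U i))).hom
      (h i - ((cechSES F U).X₂.obj.map (homOfLE (le_top : U i ≤ ⊤)).op).hom
        (Sheaf.H.equiv₀ (cechSES F U).X₂ isTerminalTop x₂)) = 0 := fun i ↦ by
    rw [map_sub, nat, hhG, sub_eq_zero]
    exact (hq i).symm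
  choose e he using fun i ↦ exists_app_eq_of_app_eq_zero_of_shortExact hS (op (U i)) _ (hd i)
  -- (5) `f(e_j - e_i) = f(c_{ij})` on `U_i ∩ U_j`, and `f` is injective on sections
  refine ⟨e, fun i j ↦ ?_⟩
  have hinj : Function.Injective (((cechSES F U).f.hom.app (op (U i ⊓ U j))).hom) := by
    have hm : Mono (cechSES F U).f := hS.mono_f
    rw [Sheaf.Hom.mono_iff_presheaf_mono, NatTrans.mono_iff_mono_app] at hm
    exact (AddCommGrpCat.mono_iff_injective _).1 (hm _)
  apply hinj
  change _ = ((cechSES F U).f.hom.app (op (U i ⊓ U j))).hom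
    (((cechSES F U).X₁.obj.map (homOfLE inf_le_right).op).hom (e j) -
      ((cechSES F U).X₁.obj.map (homOfLE inf_le_left).op).hom (e i))
  have hej : ((cechSES F U).f.hom.app (op (U j))).hom (e j) = _ := he j
  have hei : ((cechSES F U).f.hom.app (op (U i))).hom (e i) = _ := he i
  rw [map_sub, natf, natf, hej, hei, map_sub, map_sub, sheaf_map_map_apply, sheaf_map_map_apply,
    h2 i j]
  abel

end Main

section Scheme

open _root_.AlgebraicGeometry Literature.AlgebraicGeometry.Morphisms

variable {A : Type u} [CommRing A] {X : Scheme.{u}} (f : X ⟶ Spec (.of A))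

/-- The sheaf of abelian groups underlying `𝒪_X` whose `Sheaf.H` is `structureSheafCohomology X`:
the abelian sheaf of the free rank-one `𝒪_X`-module. [folklore] -/
noncomputable abbrev structureSheafAb (X : Scheme.{u}) :
    Sheaf (Opens.grothendieckTopology X) AddCommGrpCat.{u} :=
  (SheafOfModules.toSheaf X.ringCatSheaf).obj (SheafOfModules.unit X.ringCatSheaf)

/-- Sections of the abelian structure sheaf over `V` are `Γ(X, V) = Sections f V`, definitionally.
[folklore] -/
theorem structureSheafAb_obj (V : X.Opens) :
    ((structureSheafAb X).obj.obj (op V) : Type u) = Sections f V := rfl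

/-- Restriction in the abelian structure sheaf is `Sections.res`, definitionally. [folklore] -/
theorem sheafSecRes_structureSheafAb {V W : X.Opens} (h : W ≤ V) (x : Sections f V) :
    sheafSecRes (structureSheafAb X) h x = Sections.res f h x := rfl

/-- `H^q(X, 𝒪_X) = structureSheafCohomology X q` is `Sheaf.H` of `structureSheafAb X`,
definitionally. [folklore] -/
theorem structureSheafCohomology_eq_H (q : ℕ) :
    structureSheafCohomology X q = (structureSheafAb X).H q := rfl

/-- **`H¹(X, 𝒪_X) = 0` ⇒ every Čech `1`-cocycle of `𝒪_X` on every open cover of `X` is a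
coboundary** (`Ž¹(𝔘, 𝒪_X) ≤ B̌¹(𝔘, 𝒪_X)` in `Morphisms/CechH1.lean`), for a scheme `X` over a ring
`A` and a cover `𝔘` indexed in the universe of `X`.
[cite: Hartshorne1977, III Ex. 4.4 (c) with Lemma 4.4 (PDF pp. 277, 279–280)] -/
theorem cechZ1_le_cechB1_of_subsingleton_structureSheafCohomology {ι : Type u} (U : ι → X.Opens)
    (hU : iSup U = ⊤) [h1 : Subsingleton (structureSheafCohomology X 1)] :
    cechZ1 f U ≤ cechB1 f U := by
  intro c hc
  rw [mem_cechZ1_iff] at hc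
  rw [mem_cechB1_iff]
  haveI : Subsingleton ((structureSheafAb X).H 1) := h1
  obtain ⟨b, hb⟩ := exists_cech_coboundary_of_subsingleton_H_one (structureSheafAb X) U hU c
    fun i j k ↦ by
      have e := congrFun (congrFun (congrFun hc i) j) k
      exact e
  exact ⟨b, funext fun i ↦ funext fun j ↦ (hb i j).symm⟩

/-- **`H¹(X, 𝒪_X) = 0` ⇒ `Ȟ¹(𝔘, 𝒪_X) = 0` for every open cover `𝔘` of `X`** (`CechH1` of
`Morphisms/CechH1.lean`). [cite: Hartshorne1977, III Ex. 4.4 (c) with Lemma 4.4 (PDF pp. 277, 279–280)] -/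
theorem subsingleton_cechH1_of_subsingleton_structureSheafCohomology {ι : Type u}
    (U : ι → X.Opens) (hU : iSup U = ⊤) [Subsingleton (structureSheafCohomology X 1)] :
    Subsingleton (CechH1 f U) := by
  rw [Submodule.Quotient.subsingleton_iff, eq_top_iff]
  rintro z -
  exact cechZ1_le_cechB1_of_subsingleton_structureSheafCohomology f U hU z.2

/-! ### Covers indexed in an arbitrary universe -/

/-- **`H¹(X, 𝒪_X) = 0` ⇒ `Ž¹(𝔘, 𝒪_X) = B̌¹(𝔘, 𝒪_X)` for every open cover `𝔘` of `X`, indexed by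
any type** (in any universe): the cover `𝔙` of all opens contained in some `U_i` (indexed in the
universe of `X`) refines `𝔘` and covers every `U_i`, so `Ȟ¹(𝔘, 𝒪_X) → Ȟ¹(𝔙, 𝒪_X)` is injective
(`Morphisms.mem_cechB1_of_refineC1_mem_cechB1`, Görtz–Wedhorn II Cor. 21.81) and `Ȟ¹(𝔙, 𝒪_X) = 0`
by `cechZ1_le_cechB1_of_subsingleton_structureSheafCohomology`.
[cite: Hartshorne1977, III Ex. 4.4 (c) with Lemma 4.4 (PDF pp. 277, 279–280)] -/
theorem cechZ1_le_cechB1_of_subsingleton_structureSheafCohomology' {ι : Type v}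
    (U : ι → X.Opens) (hU : iSup U = ⊤) [Subsingleton (structureSheafCohomology X 1)] :
    cechZ1 f U ≤ cechB1 f U := by
  intro c hc
  let ι' := {W : X.Opens // ∃ i, W ≤ U i}
  let V : ι' → X.Opens := fun W ↦ W.1
  have hτ : ∀ W : ι', V W ≤ U (Classical.choose W.2) := fun W ↦ Classical.choose_spec W.2
  have hUV : ∀ i, U i ≤ ⨆ j, V j := fun i ↦ le_iSup V ⟨U i, i, le_rfl⟩
  have hV : iSup V = ⊤ := top_le_iff.mp (hU ▸ iSup_le hUV)
  exact mem_cechB1_of_refineC1_mem_cechB1 f U V _ hτ hUV hc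
    (cechZ1_le_cechB1_of_subsingleton_structureSheafCohomology f V hV
      (refineC1_mem_cechZ1 f U V _ hτ hc))

/-- **`H¹(X, 𝒪_X) = 0` ⇒ `Ȟ¹(𝔘, 𝒪_X) = 0` for every open cover `𝔘` of `X`, indexed by any type.**
[cite: Hartshorne1977, III Ex. 4.4 (c) with Lemma 4.4 (PDF pp. 277, 279–280)] -/
theorem subsingleton_cechH1_of_subsingleton_structureSheafCohomology' {ι : Type v}
    (U : ι → X.Opens) (hU : iSup U = ⊤) [Subsingleton (structureSheafCohomology X 1)] :
    Subsingleton (CechH1 f U) := by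
  rw [Submodule.Quotient.subsingleton_iff, eq_top_iff]
  rintro z -
  exact cechZ1_le_cechB1_of_subsingleton_structureSheafCohomology' f U hU z.2

end Scheme

end Literature.AlgebraicGeometry.Motives
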